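import Summits.CriticalPhenomena.Ising3D.IsingColumnFaceL11CensusSigmaCellTrgFin
import Summits.CriticalPhenomena.Ising3D.IsingColumnFaceL11Census
import Summits.CriticalPhenomena.Ising3D.ExclusionSentencesControl2DAlg
import Mathlib.Analysis.Calculus.Deriv.MeanValue

/-!
# The σ-cell against the whole frozen catalogue, in the kernel: family `ALG`, the assembled census, and the
counts «11 algebraic values (12 descriptions), 13 linear forms, 12 trigonometric monomials» (cell `pub-ising3x`,
seat recog-1; paper §7.3; companion of `IsingColumnFaceL11CensusSigmaCell{Lin,Trg,TrgFin}.lean`)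

HONEST FRAMING: lottery ticket; floor = tightest certified 3D Ising CFT bounds; no exact-solution claim
without a proof. Island framing: certified exclusion region at stated derivative order and assumptions; not a
determination of the 3D Ising critical exponents beyond that.
HONEST SCOPE: a statement about the frozen catalogue's members inside `σcell = [33957/65536, 16979/32768]`,
NOT about `Δσ`; Theorem 1's region has no σ-face, no bridge is instantiated (the σ-cell is the campaign's input
cell). The `ALG`/`LIN`/`TRG` counts of the `Δε`-segment (17 867 / 30 105 / 10 948 …) remain census numbers.

Paper §7.3, last sentence: «For the σ-cell itself the catalogue holds 4 rationals with denominator ≤ 1000 (…),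
12 algebraic, 13 linear-form and 12 trigonometric members (…) and no Kac, extended-Kac or named value.» With
this module every clause is a kernel fact about FAMILIES-v1 on the σ-cell:
* family `ALG` (degree `d ≤ 6`, height `≤ H_d = 1024/64/12/6/3/2`, `algTable`): `σcellAlgEx` — eleven integer
  polynomials (five linear `qX − p`: the four `q ≤ 1000` rationals of `rat_mem_σcell_iff_listed` and `528/1019`;
  four quadratics; the cubic `6X³ + 6X² + 3X − 4`; the quartic `4X⁴ − 3X³ + 6X² + X − 2`); COMPLETENESS
  `alg_listed_of_mem_σcell` (six `algExcluded` decisions on the decimal superset window `σW`, ≈ 110 s in all);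
  EXISTENCE `σcellAlgEx_root_mem_σcell` (exact rational sign change + intermediate value theorem) with
  `σcellAlgEx_root_mem_algFamily`; UNIQUENESS and ORDER (each polynomial strictly increasing on `σW` by an
  enclosure of its formal derivative; explicit rational separators order the roots) ⇒ **`σcell_alg_ncard`: the
  `ALG` members of the σ-cell are exactly 11 DISTINCT REAL VALUES (12 descriptions at the frozen grading;
  `X·(6X³ + 6X² + 3X − 4)` reducible, repeating the cubic's root)**;
* the companions' `σcell_lin_ncard` (= 13) and `σcell_trg_ncard` (= 12) enter `σcell_census`;
* **`σcell_catalogue`** — the sentence in the shape of the 2D control's `control2D_sigma_catalogue`, re-using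
  (not re-proving) p627113's `rat_mem_σcell_iff_listed`, `kac_not_mem_σcell`, `namedSigma_not_mem_σcell` and
  p639014's `kacx_not_mem_σcell`; `σcell_census` = the three counts.
Generic tools proved here (no new axiom, no Mathlib digits): `evalQ` / `evalL_ratCast`, `continuous_evalL`,
`polyDerivL` / `hasDerivAt_evalL`, `posTestQ` / `evalL_pos_of_posTestQ` (positivity on a rational interval by the
tree's scaled-integer enclosure `encloseZ`), `strictMonoOn_evalL_of_posTestQ`, `signChangeQ`, `algPolyOK`.
No certificate, datum or axiom of the σ–ε system is used. [folklore]
lottery ticket; floor = tightest certified 3D Ising CFT bounds; no exact-solution claim without a proof.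
-/

namespace Summit.CriticalPhenomena.Ising3D
namespace ColumnFaceL11
open Set Literature.MathematicalPhysics.QuantumFieldTheory.ConformalBootstrap3D

/-! ### Generic tools for integer coefficient lists: rational evaluation, continuity, derivative, positivity -/

/-- Horner evaluation of an integer coefficient list at a rational point (computable twin of `evalL`).
[folklore] -/
def evalQ : List ℤ → ℚ → ℚ
  | [], _ => 0
  | a :: cs, x => (a : ℚ) + x * evalQ cs x

/-- `evalL` at a rational point is the cast of `evalQ`. [folklore] -/
theorem evalL_ratCast : ∀ (c : List ℤ) (r : ℚ), evalL c (r : ℝ) = ((evalQ c r : ℚ) : ℝ)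
  | [], r => by simp [evalQ]
  | a :: cs, r => by rw [evalL_cons, evalL_ratCast cs r]; simp only [evalQ]; push_cast; ring

/-- `evalL c` is continuous (a polynomial function). [folklore] -/
theorem continuous_evalL : ∀ c : List ℤ, Continuous (evalL c)
  | [] => by
      have e : evalL ([] : List ℤ) = fun _ : ℝ => (0 : ℝ) := funext fun y => evalL_nil y
      rw [e]; exact continuous_const
  | a :: cs => by
      have e : evalL (a :: cs) = fun y : ℝ => (a : ℝ) + y * evalL cs y := funext fun y => evalL_cons a cs y
      rw [e]; exact continuous_const.add (continuous_id.mul (continuous_evalL cs))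

/-- Formal derivative of a coefficient list (`evalL (polyDerivL c)` is the derivative of `evalL c`,
`hasDerivAt_evalL`). [folklore] -/
def polyDerivL : List ℤ → List ℤ
  | [] => []
  | _ :: cs => polyAdd cs (0 :: polyDerivL cs)

/-- `evalL (polyDerivL c) x` is the derivative of `evalL c` at `x`. [folklore] -/
theorem hasDerivAt_evalL : ∀ (c : List ℤ) (x : ℝ), HasDerivAt (evalL c) (evalL (polyDerivL c) x) x
  | [], x => by
      have e : evalL ([] : List ℤ) = fun _ : ℝ => (0 : ℝ) := funext fun y => evalL_nil y
      rw [e]; simpa [polyDerivL] using hasDerivAt_const x (0 : ℝ)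
  | a :: cs, x => by
      have ih := hasDerivAt_evalL cs x
      have h : HasDerivAt (fun y : ℝ => (a : ℝ) + y * evalL cs y)
          (1 * evalL cs x + x * evalL (polyDerivL cs) x) x :=
        ((hasDerivAt_id' x).mul ih).const_add (a : ℝ)
      have e1 : (fun y : ℝ => (a : ℝ) + y * evalL cs y) = evalL (a :: cs) :=
        funext fun y => (evalL_cons a cs y).symm
      have e2 : 1 * evalL cs x + x * evalL (polyDerivL cs) x = evalL (polyDerivL (a :: cs)) x := by
        simp only [polyDerivL, evalL_polyAdd, evalL_cons]; push_cast; ring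
      rw [e1, e2] at h
      exact h

/-- Positivity test on `[a, b]` (`0 ≤ a`): the lower end of the scaled-integer enclosure `encloseZ` of `c` is
positive. [folklore] -/
def posTestQ (c : List ℤ) (a b : ℚ) : Bool :=
  decide (0 ≤ a) && decide (0 < (encloseZ (a.num * b.den) (b.num * a.den) ((a.den : ℤ) * b.den) c).1)

/-- Soundness of `posTestQ`: `evalL c > 0` on `[a, b]`. [folklore] -/
theorem evalL_pos_of_posTestQ {c : List ℤ} {a b : ℚ} (h : posTestQ c a b = true) {x : ℝ}
    (hx : (a : ℝ) ≤ x ∧ x ≤ b) : 0 < evalL c x := by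
  simp only [posTestQ, Bool.and_eq_true, decide_eq_true_eq] at h
  obtain ⟨ha, hU⟩ := h
  have hM : (0 : ℤ) < (a.den : ℤ) * b.den := by exact_mod_cast Nat.mul_pos a.den_pos b.den_pos
  have hLO : (0 : ℤ) ≤ a.num * b.den := mul_nonneg (Rat.num_nonneg.mpr ha) (Int.natCast_nonneg _)
  have hprod : (0 : ℝ) ≤ (a.den : ℝ) * b.den := by positivity
  have hlo : ((a.num * b.den : ℤ) : ℝ) ≤ x * (((a.den : ℤ) * b.den : ℤ) : ℝ) := by
    push_cast; rw [← ratCast_mul_den a]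
    calc (a : ℝ) * a.den * b.den = a * (a.den * b.den) := by ring
      _ ≤ x * (a.den * b.den) := mul_le_mul_of_nonneg_right hx.1 hprod
  have hhi : x * (((a.den : ℤ) * b.den : ℤ) : ℝ) ≤ ((b.num * a.den : ℤ) : ℝ) := by
    push_cast; rw [← ratCast_mul_den b]
    calc x * ((a.den : ℝ) * b.den) ≤ b * (a.den * b.den) := mul_le_mul_of_nonneg_right hx.2 hprod
      _ = (b : ℝ) * b.den * a.den := by ring
  obtain ⟨h1, _, hN⟩ := encloseZ_sound hLO hM hlo hhi c
  have hN' : (0 : ℝ) < (encloseZ (a.num * b.den) (b.num * a.den) ((a.den : ℤ) * b.den) c).2.2 := by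
    exact_mod_cast hN
  have hU' : (0 : ℝ) < (encloseZ (a.num * b.den) (b.num * a.den) ((a.den : ℤ) * b.den) c).1 := by
    exact_mod_cast hU
  rcases le_or_gt (evalL c x) 0 with hle | hpos
  · have := mul_nonpos_iff.mpr (Or.inr ⟨hle, hN'.le⟩)
    linarith
  · exact hpos

/-- A coefficient list whose formal derivative passes `posTestQ` on `[a, b]` is STRICTLY INCREASING there.
[folklore] -/
theorem strictMonoOn_evalL_of_posTestQ {q : List ℤ} {a b : ℚ} (h : posTestQ (polyDerivL q) a b = true) :
    StrictMonoOn (evalL q) (Icc (a : ℝ) b) :=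
  strictMonoOn_of_deriv_pos (convex_Icc _ _) (continuous_evalL q).continuousOn fun x hx => by
    rw [(hasDerivAt_evalL q x).deriv]
    have hx' := interior_subset hx
    exact evalL_pos_of_posTestQ h ⟨hx'.1, hx'.2⟩

/-- Sign change of `q` between the rational points `a` and `b` (negative at `a`, positive at `b`). [folklore] -/
def signChangeQ (a b : ℚ) (q : List ℤ) : Bool :=
  decide (evalQ q a < 0) && decide (0 < evalQ q b)

/-- A sign change gives a root in `[a, b]` (intermediate value theorem). [folklore] -/
theorem exists_root_of_signChangeQ {a b : ℚ} (hab : a ≤ b) {q : List ℤ} (h : signChangeQ a b q = true) :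
    ∃ x : ℝ, (a : ℝ) ≤ x ∧ x ≤ b ∧ evalL q x = 0 := by
  simp only [signChangeQ, Bool.and_eq_true, decide_eq_true_eq] at h
  obtain ⟨h1, h2⟩ := h
  have hab' : ((a : ℚ) : ℝ) ≤ b := Rat.cast_le.mpr hab
  have hfa : evalL q (a : ℝ) < 0 := by rw [evalL_ratCast]; exact_mod_cast h1
  have hfb : 0 < evalL q (b : ℝ) := by rw [evalL_ratCast]; exact_mod_cast h2
  have h0 : (0 : ℝ) ∈ Icc (evalL q (a : ℝ)) (evalL q (b : ℝ)) := ⟨hfa.le, hfb.le⟩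
  obtain ⟨x, hx, hx0⟩ := intermediate_value_Icc hab' (continuous_evalL q).continuousOn h0
  exact ⟨x, hx.1, hx.2, hx0⟩

/-- A root `x` of a coefficient list `q` of length `d + 1` with non-zero top coefficient and all coefficients
in `[−H, H]` is a member of `algFamily d H`. [folklore] -/
theorem mem_algFamily_of_root {H d : ℕ} {x : ℝ} {q : List ℤ} (hlen : q.length = d + 1)
    (hlast : q[d]'(by omega) ≠ 0) (hH : ∀ c ∈ q, |c| ≤ (H : ℤ)) (hx : evalL q x = 0) :
    x ∈ algFamily d H := by
  refine ⟨fun i => q[i.val]'(by omega), by simpa [Fin.val_last] using hlast,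
    fun i => hH _ (List.getElem_mem _), ?_⟩
  rw [← evalL_ofFn]
  have e : List.ofFn (fun i : Fin (d + 1) => q[i.val]'(by omega)) = q := by
    apply List.ext_getElem
    · rw [List.length_ofFn, hlen]
    · intro i h1 h2
      rw [List.getElem_ofFn]
  rw [e]
  exact hx

/-- Decidable side conditions for `mem_algFamily_of_root`: length `d + 1`, top coefficient non-zero, height
`≤ H`. [folklore] -/
def algPolyOK (d H : ℕ) (q : List ℤ) : Bool :=
  decide (q.length = d + 1) && decide (q[d]? ≠ some 0) && decide (q[d]? ≠ none) &&
    q.all fun c => decide (|c| ≤ (H : ℤ))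

/-- Soundness of `algPolyOK`. [folklore] -/
theorem mem_algFamily_of_algPolyOK {H d : ℕ} {x : ℝ} {q : List ℤ} (h : algPolyOK d H q = true)
    (hx : evalL q x = 0) : x ∈ algFamily d H := by
  simp only [algPolyOK, Bool.and_eq_true, decide_eq_true_eq, List.all_eq_true] at h
  obtain ⟨⟨⟨hlen, hlast⟩, _⟩, hH⟩ := h
  have hd : d < q.length := by omega
  refine mem_algFamily_of_root hlen ?_ (fun c hc => hH c hc) hx
  intro h0
  apply hlast
  rw [List.getElem?_eq_getElem hd, h0]

/-! ### Family `ALG` on the σ-cell -/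

/-- The eleven integer polynomials (constant term first) whose roots are the `ALG` members of the σ-cell,
SORTED BY ROOT: `49X²+19X−23` (0.5181451030…), `496X−257` (0.5181451612…), `6X²+49X−27` (0.5181458974…),
`799X−414` (0.5181476846…), `4X⁴−3X³+6X²+X−2` (0.5181480792…), `6X³+6X²+3X−4` (0.5181498425…), `303X−157`
(0.5181518151…), `60X²−6X−13` (0.5181523968…), `1019X−528` (0.5181550539…), `17X²+24X−17` (0.5181560027…),
`716X−371` (0.5181564245…). The recogniser's twelfth DESCRIPTION `6X⁴+6X³+3X²−4X = X·(6X³+6X²+3X−4)` (height 6)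
repeats the cubic's root (discharged by the checker's exact deflation against the listed cubic). [folklore] -/
def σcellAlgEx : List (List ℤ) :=
  [[-23, 19, 49], [-257, 496], [-27, 49, 6], [-414, 799], [-2, 1, 6, -3, 4], [-4, 3, 6, 6], [-157, 303],
   [-13, -6, 60], [-528, 1019], [-17, 24, 17], [-371, 716]]

/-- `ALG` sentence, degree 1, height `≤ 1024`, on `σW` (one `decide +kernel`, seconds). [folklore] -/
theorem algExcluded_σW_d1 : algExcluded 1 1024 σWlo σWhi 6 6 σcellAlgEx = true := by
  decide +kernel

/-- `ALG` sentence, degree 2, height `≤ 64`, on `σW` (one `decide +kernel`, ≈ 15 s). [folklore] -/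
theorem algExcluded_σW_d2 : algExcluded 2 64 σWlo σWhi 6 6 σcellAlgEx = true := by
  decide +kernel

/-- `ALG` sentence, degree 3, height `≤ 12`, on `σW`. [folklore] -/
theorem algExcluded_σW_d3 : algExcluded 3 12 σWlo σWhi 6 6 σcellAlgEx = true := by
  decide +kernel

/-- `ALG` sentence, degree 4, height `≤ 6`, on `σW`. [folklore] -/
theorem algExcluded_σW_d4 : algExcluded 4 6 σWlo σWhi 6 6 σcellAlgEx = true := by
  decide +kernel

/-- `ALG` sentence, degree 5, height `≤ 3`, on `σW` (no member: every candidate excluded). [folklore] -/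
theorem algExcluded_σW_d5 : algExcluded 5 3 σWlo σWhi 6 6 σcellAlgEx = true := by
  decide +kernel

/-- `ALG` sentence, degree 6, height `≤ 2`, on `σW` (no member). [folklore] -/
theorem algExcluded_σW_d6 : algExcluded 6 2 σWlo σWhi 6 6 σcellAlgEx = true := by
  decide +kernel

/-- **Completeness on the σ-cell, family `ALG`.** A real number in the σ-cell that is algebraic of a table rung
`(d, H_d) ∈ algTable` (degree `≤ 6`, height `≤ 1024/64/12/6/3/2`) is a root of a listed polynomial. [folklore] -/
theorem alg_listed_of_mem_σcell {x : ℝ} (hx : x ∈ σcell) {d H : ℕ} (hdH : (d, H) ∈ algTable)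
    (hm : x ∈ algFamily d H) : ∃ q ∈ σcellAlgEx, evalL q x = 0 := by
  have hx' := mem_σW_of_mem_σcell hx
  simp only [algTable, List.mem_cons, Prod.mk.injEq, List.not_mem_nil, or_false] at hdH
  rcases hdH with ⟨rfl, rfl⟩ | ⟨rfl, rfl⟩ | ⟨rfl, rfl⟩ | ⟨rfl, rfl⟩ | ⟨rfl, rfl⟩ | ⟨rfl, rfl⟩
  · exact algExcluded_sound algExcluded_σW_d1 hx' hm
  · exact algExcluded_sound algExcluded_σW_d2 hx' hm
  · exact algExcluded_sound algExcluded_σW_d3 hx' hm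
  · exact algExcluded_sound algExcluded_σW_d4 hx' hm
  · exact algExcluded_sound algExcluded_σW_d5 hx' hm
  · exact algExcluded_sound algExcluded_σW_d6 hx' hm

/-- Every listed polynomial is negative at the cell's lower end point and positive at its upper end point
(exact rational arithmetic). [folklore] -/
theorem signChangeQ_σcellAlgEx : σcellAlgEx.all (signChangeQ (33957 / 65536) (16979 / 32768)) = true := by
  decide +kernel

/-- **Existence: every listed polynomial has a root in the σ-cell.** [folklore] -/
theorem σcellAlgEx_root_mem_σcell {q : List ℤ} (hq : q ∈ σcellAlgEx) : ∃ x ∈ σcell, evalL q x = 0 := by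
  have h := List.all_eq_true.mp signChangeQ_σcellAlgEx q hq
  obtain ⟨x, h1, h2, h0⟩ := exists_root_of_signChangeQ (by norm_num) h
  refine ⟨x, ?_, h0⟩
  simp only [σcell, mem_Icc]
  push_cast at h1 h2
  exact ⟨h1, h2⟩

/-- Every listed polynomial sits on a table rung: length `d + 1`, non-zero top coefficient, height `≤ H_d` for
some `(d, H_d) ∈ algTable`. [folklore] -/
theorem algPolyOK_σcellAlgEx :
    (σcellAlgEx.all fun q => algTable.any fun dH => algPolyOK dH.1 dH.2 q) = true := by
  decide +kernel

/-- **A root of a listed polynomial is an `ALG` member of a table rung.** [folklore] -/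
theorem σcellAlgEx_root_mem_algFamily {q : List ℤ} (hq : q ∈ σcellAlgEx) {x : ℝ} (hx : evalL q x = 0) :
    ∃ dH ∈ algTable, x ∈ algFamily dH.1 dH.2 := by
  have h := List.all_eq_true.mp algPolyOK_σcellAlgEx q hq
  obtain ⟨dH, hdH, hok⟩ := List.any_eq_true.mp h
  exact ⟨dH, hdH, mem_algFamily_of_algPolyOK hok hx⟩

/-- Every listed polynomial has a positive derivative enclosure on `σW`: it is strictly increasing there.
[folklore] -/
theorem posTestQ_σcellAlgEx : (σcellAlgEx.all fun q => posTestQ (polyDerivL q) σWlo σWhi) = true := by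
  decide +kernel

/-- **Uniqueness: a listed polynomial has at most one root in the σ-cell** (it is strictly increasing on
`σW ⊇ σcell`). [folklore] -/
theorem σcellAlgEx_root_unique {q : List ℤ} (hq : q ∈ σcellAlgEx) {x y : ℝ} (hx : x ∈ σcell) (hy : y ∈ σcell)
    (hqx : evalL q x = 0) (hqy : evalL q y = 0) : x = y := by
  have hmono := strictMonoOn_evalL_of_posTestQ (List.all_eq_true.mp posTestQ_σcellAlgEx q hq)
  have hx' := mem_σW_of_mem_σcell hx
  have hy' := mem_σW_of_mem_σcell hy
  exact hmono.injOn ⟨hx'.1, hx'.2⟩ ⟨hy'.1, hy'.2⟩ (hqx.trans hqy.symm)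

/-- Rational separator just above the root of each listed polynomial (below the next root; for the last one a
point of `σW` above it). [folklore] -/
def algSepAbove : List ℤ → ℚ
  | [-23, 19, 49] => 5181451322 / 10 ^ 10
  | [-257, 496] => 5181455294 / 10 ^ 10
  | [-27, 49, 6] => 5181467910 / 10 ^ 10
  | [-414, 799] => 5181478819 / 10 ^ 10
  | [-2, 1, 6, -3, 4] => 5181489609 / 10 ^ 10
  | [-4, 3, 6, 6] => 5181508289 / 10 ^ 10
  | [-157, 303] => 5181521060 / 10 ^ 10
  | [-13, -6, 60] => 5181537254 / 10 ^ 10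
  | [-528, 1019] => 5181555284 / 10 ^ 10
  | [-17, 24, 17] => 5181562137 / 10 ^ 10
  | _ => 518157 / 10 ^ 6

/-- Order test for an (earlier, later) pair: the earlier polynomial is positive and the later one negative at
the earlier one's separator, a point of `σW`. [folklore] -/
def algPairSep (p q : List ℤ) : Bool :=
  decide (σWlo ≤ algSepAbove p) && decide (algSepAbove p ≤ σWhi) &&
    decide (0 < evalQ p (algSepAbove p)) && decide (evalQ q (algSepAbove p) < 0)

/-- The order test passes for every pair of the sorted list (exact rational arithmetic). [folklore] -/
theorem algPairSep_σcellAlgEx : σcellAlgEx.Pairwise fun p q => algPairSep p q = true := by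
  decide +kernel

/-- Soundness of the order test: the σ-cell roots of an (earlier, later) pair are strictly ordered. [folklore] -/
theorem root_lt_root_of_algPairSep {p q : List ℤ} (hp : p ∈ σcellAlgEx) (hq : q ∈ σcellAlgEx)
    (h : algPairSep p q = true) {x y : ℝ} (hx : x ∈ σcell) (hy : y ∈ σcell) (hpx : evalL p x = 0)
    (hqy : evalL q y = 0) : x < y := by
  simp only [algPairSep, Bool.and_eq_true, decide_eq_true_eq] at h
  obtain ⟨⟨⟨hm1, hm2⟩, hpm⟩, hqm⟩ := h
  set m : ℚ := algSepAbove p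
  have hmW : ((σWlo : ℚ) : ℝ) ≤ (m : ℝ) ∧ (m : ℝ) ≤ ((σWhi : ℚ) : ℝ) :=
    ⟨Rat.cast_le.mpr hm1, Rat.cast_le.mpr hm2⟩
  have hx' := mem_σW_of_mem_σcell hx
  have hy' := mem_σW_of_mem_σcell hy
  have hmonp := strictMonoOn_evalL_of_posTestQ (List.all_eq_true.mp posTestQ_σcellAlgEx p hp)
  have hmonq := strictMonoOn_evalL_of_posTestQ (List.all_eq_true.mp posTestQ_σcellAlgEx q hq)
  have hpm' : evalL p x < evalL p (m : ℝ) := by rw [hpx, evalL_ratCast]; exact_mod_cast hpm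
  have hqm' : evalL q (m : ℝ) < evalL q y := by rw [hqy, evalL_ratCast]; exact_mod_cast hqm
  have h1 : x < (m : ℝ) := (hmonp.lt_iff_lt ⟨hx'.1, hx'.2⟩ ⟨hmW.1, hmW.2⟩).mp hpm'
  have h2 : (m : ℝ) < y := (hmonq.lt_iff_lt ⟨hmW.1, hmW.2⟩ ⟨hy'.1, hy'.2⟩).mp hqm'
  exact h1.trans h2

/-! ### Counting distinct real values -/

/-- **The `ALG` members of the σ-cell are exactly 11 DISTINCT REAL VALUES** (all table rungs, degree `≤ 6`,
heights `1024/64/12/6/3/2`; 12 descriptions at the frozen grading, `X·(6X³+6X²+3X−4)` reducible). [folklore] -/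
theorem σcell_alg_ncard :
    {x : ℝ | x ∈ σcell ∧ ∃ dH ∈ algTable, x ∈ algFamily dH.1 dH.2}.ncard = 11 := by
  -- a root selector for the listed polynomials
  have hex : ∀ q : List ℤ, ∃ x : ℝ, q ∈ σcellAlgEx → x ∈ σcell ∧ evalL q x = 0 := fun q => by
    by_cases hq : q ∈ σcellAlgEx
    · obtain ⟨x, hx, h0⟩ := σcellAlgEx_root_mem_σcell hq
      exact ⟨x, fun _ => ⟨hx, h0⟩⟩
    · exact ⟨0, fun h => absurd h hq⟩
  choose ρ hρ using hex
  have hiff : ∀ r, r ∈ {x : ℝ | x ∈ σcell ∧ ∃ dH ∈ algTable, x ∈ algFamily dH.1 dH.2} ↔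
      r ∈ σcellAlgEx.map ρ := fun r => by
    rw [List.mem_map]
    constructor
    · rintro ⟨hr, dH, hdH, hm⟩
      obtain ⟨d, H⟩ := dH
      obtain ⟨q, hq, h0⟩ := alg_listed_of_mem_σcell hr hdH hm
      exact ⟨q, hq, σcellAlgEx_root_unique hq (hρ q hq).1 hr (hρ q hq).2 h0⟩
    · rintro ⟨q, hq, rfl⟩
      exact ⟨(hρ q hq).1, σcellAlgEx_root_mem_algFamily hq (hρ q hq).2⟩
  have hnodup : (σcellAlgEx.map ρ).Nodup := by
    rw [List.Nodup, List.pairwise_map]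
    exact algPairSep_σcellAlgEx.imp_of_mem fun {p q} hp hq h =>
      ne_of_lt (root_lt_root_of_algPairSep hp hq h (hρ p hp).1 (hρ q hq).1 (hρ p hp).2 (hρ q hq).2)
  rw [real_ncard_eq_length_of_iff hnodup hiff]
  simp [σcellAlgEx]

/-! ### The σ-cell against the whole frozen catalogue -/

/-- **The frozen catalogue on the σ-cell, complete, in the kernel** (paper §7.3; the shape of the 2D control's
`control2D_sigma_catalogue`). A real number in `σcell` that is a member of a FAMILIES-v1 family (kind `Delta`,
table bounds) is: one of the four rationals `157/303, 257/496, 371/716, 414/799` (denominator `≤ 1000`); no Kac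
value (`p′ ≤ 24`, `n ≤ 8`) and no extended-table value; a root of one of the eleven polynomials `σcellAlgEx`;
one of the thirteen `LIN` tuples `σcellLinEx`; one of the twelve `TRG` tuples `σcellTrgGEx`; no `NAMED` value.
About the catalogue's density in the campaign's input cell, NOT about `Δσ` of the 3D Ising CFT. [folklore] -/
theorem σcell_catalogue {x : ℝ} (hx : x ∈ σcell) :
    (∀ r : ℚ, r.den ≤ 1000 → x = (r : ℝ) → r ∈ ([157 / 303, 257 / 496, 371 / 716, 414 / 799] : List ℚ)) ∧
    (∀ v ∈ kacFamily 24 8, x ≠ (v : ℝ)) ∧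
    (∀ v ∈ kacxFamily, x ≠ (v : ℝ)) ∧
    (∀ d H : ℕ, (d, H) ∈ algTable → x ∈ algFamily d H → ∃ q ∈ σcellAlgEx, evalL q x = 0) ∧
    (x ∈ linFamily 12 → ∃ e ∈ σcellLinEx, x = lin7TupleVal e) ∧
    (x ∈ trgFullFamily 17 32 → ∃ e ∈ σcellTrgGEx, x = trgGTupleVal e) ∧
    (∀ v ∈ namedSigma, x ≠ ((v : ℚ) : ℝ)) :=
  ⟨fun r hden hxr => rat_mem_σcell_iff_listed r hden (hxr ▸ hx),
    fun v hv hxv => kac_not_mem_σcell v hv (hxv ▸ hx),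
    fun v hv hxv => kacx_not_mem_σcell v hv (hxv ▸ hx),
    fun _ _ hdH hm => alg_listed_of_mem_σcell hx hdH hm,
    fun hm => lin_listed_of_mem_σcell hx hm,
    fun hm => trgFull_listed_of_mem_σcell hx hm,
    fun v hv hxv => namedSigma_not_mem_σcell v hv (hxv ▸ hx)⟩

/-- The census in numbers: 11 algebraic values (12 descriptions), 13 linear forms, 12 trigonometric monomials
(with p627113 / p639014: 4 rationals of denominator `≤ 1000`, no Kac / extended-Kac / named value). [folklore] -/
theorem σcell_census :
    {x : ℝ | x ∈ σcell ∧ ∃ dH ∈ algTable, x ∈ algFamily dH.1 dH.2}.ncard = 11 ∧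
    {x : ℝ | x ∈ σcell ∧ x ∈ linFamily 12}.ncard = 13 ∧
    {x : ℝ | x ∈ σcell ∧ x ∈ trgFullFamily 17 32}.ncard = 12 :=
  ⟨σcell_alg_ncard, σcell_lin_ncard, σcell_trg_ncard⟩

end ColumnFaceL11
end Summit.CriticalPhenomena.Ising3D
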